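import Mathlib
import Summits.ValiantsHypothesis.ValiantsHypothesis.Theses.ValuativeGCT

/-!
# `ValuativeGCT.ValuativeFlip` (stmt-ValiantsHypothesis-12624), det census — line restriction tools for ORDER-ONE
# cut witnesses

Tools for `ValuativeGCTValuativeFlipOddDegreeBite` (wall-breaker axis "det-orbit-closure multiplicity bounds for the det
census").  To certify that a form `H` does NOT vanish to order `2` along a linear locus `L` it suffices to restrict it
to a line `p + s · n` through a point `p ∈ L`: the algebra map `ψ : X_v ↦ C (p v) + C (n v) · s` into `ℂ[s]` sends the
vanishing ideal `I(L)` into `(s)` (`frl_X_dvd_of_mem_vanishingIdeal`: `ψ F (0) = F(p) = 0`), hence `I(L)^2` into `(s^2)`,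
so the `s¹`-coefficient of `ψ H` vanishes for `H ∈ I(L)^2` (`frl_coeff_one_eq_zero_of_mem_sq`).  The fifth-row
determinant used by the odd-degree witness: `det (s_P + s E₂₂) = s` (`frl_det_sP_add`) and, placed by
`e : Fin 3 ⊕ κ ≃ Fin m` next to an invertible block `Y`, `det ((s_P ⊕ Y) + s (E₂₂ ⊕ 0)) = s · det Y` (`frl_det_fifthRow`).
[folklore]
-/

namespace Summit.ValiantsHypothesis.ValiantsHypothesis.Theorems.ValuativeFlip

open Literature.NumberTheory.DiophantineGeometry Literature.Computability.AlgebraicComplexity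
open MvPolynomial
open scoped BigOperators Matrix Kronecker Polynomial

-- `Summit.ValiantsHypothesis.ValiantsHypothesis.…` is the tree's mandated single-conjunct layout (Sub = Summit).
set_option linter.dupNamespace false

noncomputable section

/-! ### §1 Restriction to a line through a point of `L`: `I(L)` goes to `(s)`, `I(L)^2` to `(s^2)` -/

/-- The line restriction `ψ : X_v ↦ C (p v) + C (n v) · s` evaluated at `s = 0` is evaluation at `p`. [folklore] -/
theorem frl_eval_zero_lineMap {σ : Type*} (p n : σ → ℂ) (F : MvPolynomial σ ℂ) :
    Polynomial.eval 0 (MvPolynomial.aeval (R := ℂ)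
        (fun v : σ => Polynomial.C (p v) + Polynomial.C (n v) * Polynomial.X) F) =
      MvPolynomial.eval p F := by
  have h : (Polynomial.evalRingHom (0 : ℂ)).comp (MvPolynomial.aeval (R := ℂ)
        (fun v : σ => Polynomial.C (p v) + Polynomial.C (n v) * Polynomial.X)).toRingHom =
      MvPolynomial.eval p := by
    refine MvPolynomial.ringHom_ext (fun c => ?_) (fun v => ?_)
    · simp
    · simp
  exact RingHom.congr_fun h F

/-- Hence `ψ` maps the vanishing ideal of any `L ∋ p` into the ideal `(s)`: `s ∣ ψ F`. [folklore] -/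
theorem frl_X_dvd_of_mem_vanishingIdeal {σ : Type*} {p : σ → ℂ} (n : σ → ℂ) {L : Set (σ → ℂ)} (hp : p ∈ L)
    {F : MvPolynomial σ ℂ} (hF : F ∈ MvPolynomial.vanishingIdeal ℂ L) :
    Polynomial.X ∣ MvPolynomial.aeval (R := ℂ)
      (fun v : σ => Polynomial.C (p v) + Polynomial.C (n v) * Polynomial.X) F := by
  rw [Polynomial.X_dvd_iff, Polynomial.coeff_zero_eq_eval_zero, frl_eval_zero_lineMap]
  rw [mem_vanishingIdeal_iff] at hF
  exact hF p hp

/-- And `I(L)^2` into `(s^2)`: the `s¹`-coefficient of `ψ H` vanishes for `H ∈ I(L)^2`. [folklore] -/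
theorem frl_coeff_one_eq_zero_of_mem_sq {σ : Type*} {p : σ → ℂ} (n : σ → ℂ) {L : Set (σ → ℂ)} (hp : p ∈ L)
    {H : MvPolynomial σ ℂ} (hH : H ∈ MvPolynomial.vanishingIdeal ℂ L ^ 2) :
    (MvPolynomial.aeval (R := ℂ)
      (fun v : σ => Polynomial.C (p v) + Polynomial.C (n v) * Polynomial.X) H).coeff 1 = 0 := by
  set ψ := MvPolynomial.aeval (R := ℂ) (fun v : σ => Polynomial.C (p v) + Polynomial.C (n v) * Polynomial.X) with hψ
  have hmap : Ideal.map ψ (MvPolynomial.vanishingIdeal ℂ L) ≤ Ideal.span {(Polynomial.X : ℂ[X])} := by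
    refine Ideal.map_le_iff_le_comap.mpr fun F hF => ?_
    rw [Ideal.mem_comap, Ideal.mem_span_singleton]
    exact frl_X_dvd_of_mem_vanishingIdeal n hp hF
  have h2 : ψ H ∈ Ideal.span {(Polynomial.X : ℂ[X])} ^ 2 := by
    have h1 := Ideal.mem_map_of_mem ψ hH
    rw [Ideal.map_pow] at h1
    exact Ideal.pow_right_mono hmap 2 h1
  rw [Ideal.span_singleton_pow, Ideal.mem_span_singleton, Polynomial.X_pow_dvd_iff] at h2
  exact h2 1 (by norm_num)

/-! ### §2 The fifth row: `det (s_P + s · E₂₂) = s` -/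

/-- `det (s_P + s · E₂₂) = s` for the elementary skew `s_P = E₀₁ - E₁₀`. [folklore] -/
theorem frl_det_sP_add (s : ℂ[X]) :
    ((!![0, 1, 0; -1, 0, 0; 0, 0, 0] : Matrix (Fin 3) (Fin 3) ℂ).map Polynomial.C +
        s • (!![0, 0, 0; 0, 0, 0; 0, 0, 1] : Matrix (Fin 3) (Fin 3) ℂ).map Polynomial.C).det = s := by
  rw [Matrix.det_fin_three]
  simp [Matrix.map_apply, Matrix.add_apply, Matrix.smul_apply]

/-- The fifth row and its perturbation, placed by `e`: `det (R + s Q) = s · det Y` for `R = s_P ⊕ Y`, `Q = E₂₂ ⊕ 0`. [folklore] -/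
theorem frl_det_fifthRow {m : ℕ} {κ : Type*} [Fintype κ] [DecidableEq κ] (e : Fin 3 ⊕ κ ≃ Fin m) (Y : Matrix κ κ ℂ)
    (s : ℂ[X]) :
    ((Matrix.reindex e e (Matrix.fromBlocks (!![0, 1, 0; -1, 0, 0; 0, 0, 0] : Matrix (Fin 3) (Fin 3) ℂ) 0 0 Y)).map
          Polynomial.C +
        s • (Matrix.reindex e e (Matrix.fromBlocks (!![0, 0, 0; 0, 0, 0; 0, 0, 1] : Matrix (Fin 3) (Fin 3) ℂ) 0 0
          (0 : Matrix κ κ ℂ))).map Polynomial.C).det = s * Polynomial.C Y.det := by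
  have h : (Matrix.reindex e e (Matrix.fromBlocks (!![0, 1, 0; -1, 0, 0; 0, 0, 0] : Matrix (Fin 3) (Fin 3) ℂ) 0 0 Y)).map
          Polynomial.C +
        s • (Matrix.reindex e e (Matrix.fromBlocks (!![0, 0, 0; 0, 0, 0; 0, 0, 1] : Matrix (Fin 3) (Fin 3) ℂ) 0 0
          (0 : Matrix κ κ ℂ))).map Polynomial.C =
      Matrix.reindex e e (Matrix.fromBlocks
        ((!![0, 1, 0; -1, 0, 0; 0, 0, 0] : Matrix (Fin 3) (Fin 3) ℂ).map Polynomial.C +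
          s • (!![0, 0, 0; 0, 0, 0; 0, 0, 1] : Matrix (Fin 3) (Fin 3) ℂ).map Polynomial.C) 0 0 (Y.map Polynomial.C)) := by
    simp only [Matrix.reindex_apply, ← Matrix.submatrix_map, Matrix.fromBlocks_map]
    ext a b
    simp only [Matrix.add_apply, Matrix.smul_apply, Matrix.submatrix_apply]
    cases e.symm a <;> cases e.symm b <;> simp [Matrix.fromBlocks]
  rw [h, Matrix.det_reindex_self, Matrix.det_fromBlocks_zero₂₁, frl_det_sP_add, RingHom.map_det, RingHom.mapMatrix_apply]

end

end Summit.ValiantsHypothesis.ValiantsHypothesis.Theorems.ValuativeFlip
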